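import Literature.Computability.Complexity.BinarySearchPP
import Literature.Computability.Complexity.BranchingFn
import HarnessLib

/-!
# Oracle-driven adaptive protocols: a `P^{K ⊕ G}` machine that lets the oracle `K` do the thinking

Topic `Computability/Complexity`, toolkit continuing `AdaptiveQueries.lean` (bounded adaptive
reductions `adAlg Q q D`, `adLang_mem_PRel`). This file isolates the *classical* part of the
deterministic simulation in Fortnow–Rogers' proof of `P^C = BQP^C` for their oracle
`C = H ⊕ G` (JCSS 1999, Thm. 4.2, p. 7: the polynomial-time machine `N` "can use its access to
`H` to figure out what `M` would do", asks `H` for the sensitive set `S`, "then queries `G` for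
each of those strings", and finally simulates): a polynomial-time oracle machine whose every
decision is delegated to one half `K` of a joined oracle, while the other half `G` is only
*probed* on strings that `K` spells out.

**The protocol.** A *brain* is a function `plan : List (List Bool × Bool) → Action` from the list
of probe results obtained so far (pairs (string probed, answer)) to the next action: `probe z`
or `halt v`. The brain talks one bit per round in 2-bit tokens — `SEP = 00`, `DATA b = 1b`,
`MARK = 01` — a probe segment being `SEP · DATA z_{|z|-1} ⋯ DATA z₀ · MARK` (`talk`), after which
the next round is the probe of `1z` (answered by `G`), and a halting brain says `v v v …`. The
machine (`adAlg` with query map `qryFn pay` and verdict language `LastTrue`) keeps the whole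
history `h` of answer bits and, every round, either

* detects with a 4-state transducer (`pendT`) that `h` ends with a completed `MARK`, extracts
  `z` from the reversed history with a 6-state transducer (`extT ∘ reverse`) and queries `1z`; or
* asks the brain the question `0⟨pay x, h⟩` (`pay ∈ FP` the payload describing the instance),

and accepts iff the last answer bit is `1`. Nothing here is a new Turing machine: the query map is
assembled from the tree's `FP` bricks (`FST.polyTimeComputable_eval`, `reverse_mem_FP`,
`condFn_mem_FP`, `fanoutFn_mem_FP`, …), so `protoLang pay q K G ∈ P^{K ⊕ G}` is
`adLang_mem_PRel` (`protoLang_mem_PRel`).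

**The theorem** (`mem_protoLang_iff`). If `K` answers every question `⟨pay x, h⟩` with the
brain's next bit `kbit plan h` (the brain recomputes its state from `h`: `state`, a left fold of
`step`), then the history after `r` rounds is the canonical one (`adBits_eq_hist`), the probe
results are `results plan g J` with `g = G.boolIndicator` (the true answers), and once the brain
halts — `plan (results plan g J) = halt v` — every later answer bit is `v`; so for a round budget
`q(|x|)` beyond the halting round, `x ∈ protoLang pay q K G ↔ v = true`. The halting round is at
most `J (2ℓ + 5)` when the probed strings have length `≤ ℓ` (`segStart_le`,
`mem_protoLang_iff_of_le`).

The join `K ⊕ G` is `joinLang K G = {0w | w ∈ K} ∪ {1w | w ∈ G}` (the same set as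
`Literature.Barriers.QuantumAdvantage.oracleJoin`, which lives in the barrier catalogue and is not
imported into this toolkit file).

## References

* [FortnowRogers1999JCSS] L. Fortnow, J. Rogers, *Complexity limitations on quantum
  computation*, JCSS 59 (1999) 240–252 (arXiv:cs/9811023), proof of Thm. 4.2, p. 7.
* [LadnerLynchSelman1975] R. E. Ladner, N. A. Lynch, A. L. Selman, *A comparison of polynomial
  time reducibilities*, TCS 1 (1975), §2 (`≤ᵖ_T`: the next query may depend on earlier answers).
* [AroraBarakCC2009] S. Arora, B. Barak, *Computational Complexity*, CUP 2009, §3.4.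
-/

namespace Literature.Computability.Complexity

open _root_.Computability Polynomial OracleCompose

namespace BrainProtocol

/-! ### The join of two oracle languages -/

/-- The join `K ⊕ G`: the query `0w` is answered by `K` on `w`, the query `1w` by `G` on `w`, the
empty query by "no". [cite: FortnowRogers1999JCSS, proof of Thm. 4.2 (C = H ⊕ G)] -/
def joinLang (K G : Set (List Bool)) : Set (List Bool) :=
  {s | ∃ w, (s = false :: w ∧ w ∈ K) ∨ (s = true :: w ∧ w ∈ G)}

/-- Queries `0w` go to `K`. [folklore] -/
@[simp] theorem false_cons_mem_joinLang {K G : Set (List Bool)} {w : List Bool} :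
    false :: w ∈ joinLang K G ↔ w ∈ K := by
  constructor
  · rintro ⟨w', ⟨h, hw⟩ | ⟨h, -⟩⟩
    · cases h; exact hw
    · cases h
  · exact fun h => ⟨w, Or.inl ⟨rfl, h⟩⟩

/-- Queries `1w` go to `G`. [folklore] -/
@[simp] theorem true_cons_mem_joinLang {K G : Set (List Bool)} {w : List Bool} :
    true :: w ∈ joinLang K G ↔ w ∈ G := by
  constructor
  · rintro ⟨w', ⟨h, -⟩ | ⟨h, hw⟩⟩
    · cases h
    · cases h; exact hw
  · exact fun h => ⟨w, Or.inr ⟨rfl, h⟩⟩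

/-- The empty query is not in the join. [folklore] -/
@[simp] theorem nil_not_mem_joinLang {K G : Set (List Bool)} : ([] : List Bool) ∉ joinLang K G := by
  rintro ⟨w, ⟨h, -⟩ | ⟨h, -⟩⟩ <;> cases h

/-- Membership of a `cons` in the join, by cases on the head bit. [folklore] -/
theorem cons_mem_joinLang {K G : Set (List Bool)} (b : Bool) (w : List Bool) :
    b :: w ∈ joinLang K G ↔ (b = false ∧ w ∈ K) ∨ (b = true ∧ w ∈ G) := by
  cases b <;> simp

/-! ### Brains and their talk -/

/-- What a brain wants next: probe the string `z` of the other oracle, or halt with verdict `v`.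
[cite: FortnowRogers1999JCSS, proof of Thm. 4.2 (p. 7)] -/
inductive Action
  /-- probe `z` (the machine will query `1z`) -/
  | probe (z : List Bool)
  /-- halt with verdict `v` -/
  | halt (v : Bool)

/-- The data tokens spelling `z`, last bit first: `DATA z_{|z|-1} ⋯ DATA z₀` with `DATA b = 1b`;
defined through its reversal `z₀ 1 z₁ 1 ⋯` (what the extractor reads). [folklore] -/
def dataBits (z : List Bool) : List Bool :=
  (z.flatMap fun b => [b, true]).reverse

/-- The talk of a probe segment: `SEP · data · MARK` = `00 · dataBits z · 01`. [folklore] -/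
def probeTalk (z : List Bool) : List Bool :=
  [false, false] ++ dataBits z ++ [false, true]

variable (plan : List (List Bool × Bool) → Action)

/-- What the brain says in the segment determined by the results `R`: the probe talk, or the idle
token `v v` of a halted brain. [folklore] -/
def talk (R : List (List Bool × Bool)) : List Bool :=
  match plan R with
  | .probe z => probeTalk z
  | .halt v => [v, v]

/-- The brain's parse state of a history: the probe results read off so far and the unsaid rest
of the current segment's talk. [folklore] -/
structure St where
  /-- probe results (string, answer bit) so far -/
  res : List (List Bool × Bool)
  /-- remaining bits of the current talk -/
  buf : List Bool

/-- Initial parse state: no results, the first talk unsaid. [folklore] -/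
def init : St := ⟨[], talk plan []⟩

/-- One round of parsing: a bit said by the brain is skipped; when the talk is exhausted the bit
is a probe answer (recorded, next segment) for a probing brain, or the first bit of a fresh idle
token for a halted one. [folklore] -/
def step (s : St) (c : Bool) : St :=
  match s.buf with
  | _ :: rest => ⟨s.res, rest⟩
  | [] =>
    match plan s.res with
    | .probe z => ⟨s.res ++ [(z, c)], talk plan (s.res ++ [(z, c)])⟩
    | .halt _ => ⟨s.res, (talk plan s.res).tail⟩

/-- The parse state after a history (left fold of `step`). [folklore] -/
def state (h : List Bool) : St := h.foldl (step plan) (init plan)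

/-- **The brain's answer** after the history `h`: the next unsaid bit of the current talk; with
the talk exhausted, the verdict if halted (junk `false` if a probe answer is awaited — the machine
never asks then). [cite: FortnowRogers1999JCSS, proof of Thm. 4.2 (p. 7)] -/
def kbit (h : List Bool) : Bool :=
  match (state plan h).buf with
  | b :: _ => b
  | [] =>
    match plan (state plan h).res with
    | .halt v => v
    | .probe _ => false

/-- The pending probe after the history `h`, if the current talk is exhausted and the brain wants
a probe. [folklore] -/
def pending (h : List Bool) : Option (List Bool) :=
  match (state plan h).buf with
  | _ :: _ => none
  | [] =>
    match plan (state plan h).res with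
    | .probe z => some z
    | .halt _ => none

/-- The next answer bit of the canonical run with probe answers `g`: the probe answer if a probe
is pending, else the brain's bit. [folklore] -/
def nextBit (g : List Bool → Bool) (h : List Bool) : Bool :=
  match pending plan h with
  | some z => g z
  | none => kbit plan h

/-- One canonical round. [folklore] -/
def next (g : List Bool → Bool) (h : List Bool) : List Bool := h ++ [nextBit plan g h]

/-- A pending probe is answered by `g`. [folklore] -/
theorem nextBit_of_pending_some {g : List Bool → Bool} {h z : List Bool} (hq : pending plan h = some z) :
    nextBit plan g h = g z := by
  simp [nextBit, hq]

/-- Without a pending probe the brain speaks. [folklore] -/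
theorem nextBit_of_pending_none {g : List Bool → Bool} {h : List Bool} (hq : pending plan h = none) :
    nextBit plan g h = kbit plan h := by
  simp [nextBit, hq]

/-- **The canonical history** after `r` rounds. [folklore] -/
def hist (g : List Bool → Bool) (r : ℕ) : List Bool := (next plan g)^[r] []

/-- **The probe results** after `J` probes of the canonical run (frozen once the brain halts).
[folklore] -/
def results (g : List Bool → Bool) : ℕ → List (List Bool × Bool)
  | 0 => []
  | J + 1 =>
    match plan (results g J) with
    | .probe z => results g J ++ [(z, g z)]
    | .halt _ => results g J

/-- The round at which the `J`-th segment starts (all earlier talks said and probes answered).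
[folklore] -/
def segStart (g : List Bool → Bool) : ℕ → ℕ
  | 0 => 0
  | J + 1 =>
    match plan (results plan g J) with
    | .probe _ => segStart g J + ((talk plan (results plan g J)).length + 1)
    | .halt _ => segStart g J

/-! ### Elementary facts about the parse -/

variable {plan}

/-- The empty history parses to the initial state. [folklore] -/
@[simp] theorem state_nil : state plan [] = init plan := rfl

/-- Parsing one more bit. [folklore] -/
theorem state_append_singleton (h : List Bool) (c : Bool) :
    state plan (h ++ [c]) = step plan (state plan h) c := by
  simp [state, List.foldl_append]

/-- Round `0`: empty history. [folklore] -/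
@[simp] theorem hist_zero (g : List Bool → Bool) : hist plan g 0 = [] := rfl

/-- One more canonical round. [folklore] -/
theorem hist_succ (g : List Bool → Bool) (r : ℕ) : hist plan g (r + 1) = next plan g (hist plan g r) := by
  rw [hist, Function.iterate_succ_apply']; rfl

/-- `i` more canonical rounds. [folklore] -/
theorem hist_add (g : List Bool → Bool) (r i : ℕ) : hist plan g (r + i) = (next plan g)^[i] (hist plan g r) := by
  rw [hist, hist, add_comm, Function.iterate_add_apply]

/-- A round adds one bit. [folklore] -/
@[simp] theorem length_next (g : List Bool → Bool) (h : List Bool) : (next plan g h).length = h.length + 1 := by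
  simp [next]

/-- The history of round `r` has `r` bits. [folklore] -/
@[simp] theorem length_hist (g : List Bool → Bool) (r : ℕ) : (hist plan g r).length = r := by
  induction r with
  | zero => rfl
  | succ r ih => rw [hist_succ, length_next, ih]

/-- The talk of a segment is never empty. [folklore] -/
theorem talk_ne_nil (R : List (List Bool × Bool)) : talk plan R ≠ [] := by
  unfold talk; split <;> simp [probeTalk]

/-- Length of a probe talk. [folklore] -/
@[simp] theorem length_probeTalk (z : List Bool) : (probeTalk z).length = 2 * z.length + 4 := by
  simp [probeTalk, dataBits, List.length_flatMap]; omega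

/-- A round in which the brain speaks: the said bit is skipped. [folklore] -/
theorem next_of_buf_cons (g : List Bool → Bool) {h : List Bool} {b : Bool} {rest : List Bool}
    {R : List (List Bool × Bool)} (hs : state plan h = ⟨R, b :: rest⟩) :
    next plan g h = h ++ [b] ∧ state plan (next plan g h) = ⟨R, rest⟩ := by
  have hb : nextBit plan g h = b := by
    simp [nextBit, pending, kbit, hs]
  refine ⟨by rw [next, hb], ?_⟩
  rw [next, hb, state_append_singleton, hs]
  simp [step]

/-- Saying `i` more bits of the current talk. [folklore] -/
theorem iterate_next_of_buf (g : List Bool → Bool) {R : List (List Bool × Bool)} :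
    ∀ (i : ℕ) {h pre rest : List Bool}, pre.length = i → state plan h = ⟨R, pre ++ rest⟩ →
      (next plan g)^[i] h = h ++ pre ∧ state plan ((next plan g)^[i] h) = ⟨R, rest⟩
  | 0, h, pre, rest, hlen, hs => by
    obtain rfl : pre = [] := List.eq_nil_of_length_eq_zero hlen
    exact ⟨by simp, by simpa using hs⟩
  | i + 1, h, pre, rest, hlen, hs => by
    obtain ⟨b, pre, rfl⟩ : ∃ b pre', pre = b :: pre' := by
      cases pre with
      | nil => simp at hlen
      | cons b pre' => exact ⟨b, pre', rfl⟩
    have h1 := next_of_buf_cons g (b := b) (rest := pre ++ rest) (R := R) (by simpa using hs)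
    have ih := iterate_next_of_buf g i (h := next plan g h) (pre := pre) (rest := rest)
      (by simpa using hlen) h1.2
    rw [Function.iterate_succ_apply, ih.1, h1.1]
    exact ⟨by simp, by rw [← h1.1, ← ih.1]; exact ih.2⟩

/-- A probe round: the answer `g z` is recorded and the next segment begins. [folklore] -/
theorem next_of_probe (g : List Bool → Bool) {h : List Bool} {R : List (List Bool × Bool)} {z : List Bool}
    (hs : state plan h = ⟨R, []⟩) (hp : plan R = .probe z) :
    next plan g h = h ++ [g z] ∧
      state plan (next plan g h) = ⟨R ++ [(z, g z)], talk plan (R ++ [(z, g z)])⟩ := by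
  have hb : nextBit plan g h = g z := by
    simp [nextBit, pending, hs, hp]
  refine ⟨by rw [next, hb], ?_⟩
  rw [next, hb, state_append_singleton, hs]
  simp [step, hp]

/-- An idle round of a halted brain with its talk exhausted: it says `v` and reloads `[v]`. [folklore] -/
theorem next_of_halt_nil (g : List Bool → Bool) {h : List Bool} {R : List (List Bool × Bool)} {v : Bool}
    (hs : state plan h = ⟨R, []⟩) (hp : plan R = .halt v) :
    next plan g h = h ++ [v] ∧ state plan (next plan g h) = ⟨R, [v]⟩ := by
  have hb : nextBit plan g h = v := by
    simp [nextBit, pending, kbit, hs, hp]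
  refine ⟨by rw [next, hb], ?_⟩
  rw [next, hb, state_append_singleton, hs]
  simp [step, hp, talk]

/-- **Idle rounds**: a halted brain whose buffer holds only `v`s keeps saying `v`. [folklore] -/
theorem iterate_next_of_halt (g : List Bool → Bool) {R : List (List Bool × Bool)} {v : Bool}
    (hp : plan R = .halt v) :
    ∀ (i : ℕ) {h : List Bool} {k : ℕ}, state plan h = ⟨R, List.replicate k v⟩ →
      (next plan g)^[i] h = h ++ List.replicate i v ∧
        ∃ k', state plan ((next plan g)^[i] h) = ⟨R, List.replicate k' v⟩
  | 0, h, k, hs => ⟨by simp, k, by simpa using hs⟩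
  | i + 1, h, k, hs => by
    have h1 : next plan g h = h ++ [v] ∧ ∃ k', state plan (next plan g h) = ⟨R, List.replicate k' v⟩ := by
      cases k with
      | zero => exact ⟨(next_of_halt_nil g hs hp).1, 1, (next_of_halt_nil g hs hp).2⟩
      | succ k =>
        have h2 := next_of_buf_cons g (b := v) (rest := List.replicate k v) (R := R)
          (by simpa [List.replicate_succ] using hs)
        exact ⟨h2.1, k, h2.2⟩
    obtain ⟨k', hk'⟩ := h1.2
    obtain ⟨ih1, ih2⟩ := iterate_next_of_halt g hp i hk'
    refine ⟨?_, ?_⟩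
    · rw [Function.iterate_succ_apply, ih1, h1.1, List.append_assoc, List.singleton_append,
        List.replicate_succ]
    · rw [Function.iterate_succ_apply]; exact ih2

/-! ### The canonical run, segment by segment -/

/-- Once halted, the results are frozen. [folklore] -/
theorem results_succ_of_halt (g : List Bool → Bool) {J : ℕ} {v : Bool}
    (hp : plan (results plan g J) = .halt v) : results plan g (J + 1) = results plan g J := by
  simp [results, hp]

/-- A probing brain extends the results by the probe and its true answer. [folklore] -/
theorem results_succ_of_probe (g : List Bool → Bool) {J : ℕ} {z : List Bool}
    (hp : plan (results plan g J) = .probe z) : results plan g (J + 1) = results plan g J ++ [(z, g z)] := by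
  simp [results, hp]

/-- Every recorded answer is the true one. [folklore] -/
theorem results_answer (g : List Bool → Bool) : ∀ (J : ℕ) {p : List Bool × Bool}, p ∈ results plan g J → p.2 = g p.1
  | 0, p, hp => by simp [results] at hp
  | J + 1, p, hp => by
    cases hq : plan (results plan g J) with
    | halt v => rw [results_succ_of_halt g hq] at hp; exact results_answer g J hp
    | probe z =>
      rw [results_succ_of_probe g hq, List.mem_append, List.mem_singleton] at hp
      rcases hp with hp | rfl
      · exact results_answer g J hp
      · rfl

/-- Earlier results are a prefix of later ones. [folklore] -/
theorem results_prefix (g : List Bool → Bool) {J J' : ℕ} (h : J ≤ J') : results plan g J <+: results plan g J' := by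
  induction h with
  | refl => exact List.prefix_refl _
  | @step J' _ ih =>
    refine ih.trans ?_
    cases hq : plan (results plan g J') with
    | halt v => rw [results_succ_of_halt g hq]
    | probe z => rw [results_succ_of_probe g hq]; exact List.prefix_append _ _

/-- While the brain keeps probing, `results J` has exactly `J` entries. [folklore] -/
theorem length_results (g : List Bool → Bool) :
    ∀ J : ℕ, (∀ J' < J, ∃ z, plan (results plan g J') = .probe z) → (results plan g J).length = J
  | 0, _ => rfl
  | J + 1, h => by
    obtain ⟨z, hz⟩ := h J (Nat.lt_succ_self J)
    rw [results_succ_of_probe g hz, List.length_append, List.length_singleton,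
      length_results g J fun J' hJ' => h J' (Nat.lt_succ_of_lt hJ')]

/-- The string probed at stage `J` is recorded at position `J`. [folklore] -/
theorem results_succ_eq_of_forall_probe (g : List Bool → Bool) {J : ℕ} {z : List Bool}
    (hz : plan (results plan g J) = .probe z) : (z, g z) ∈ results plan g (J + 1) := by
  rw [results_succ_of_probe g hz]; simp

/-- **Segment starts**: at round `segStart J` the history has recorded exactly `results J` and
the `J`-th talk is unsaid. [folklore] -/
theorem state_hist_segStart (g : List Bool → Bool) :
    ∀ J : ℕ, state plan (hist plan g (segStart plan g J)) = ⟨results plan g J, talk plan (results plan g J)⟩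
  | 0 => rfl
  | J + 1 => by
    have ih := state_hist_segStart g J
    cases hp : plan (results plan g J) with
    | halt v =>
      have h1 : segStart plan g (J + 1) = segStart plan g J := by simp [segStart, hp]
      rw [h1, results_succ_of_halt g hp, ih]
    | probe z =>
      have h1 : segStart plan g (J + 1) = segStart plan g J + ((talk plan (results plan g J)).length + 1) := by
        simp [segStart, hp]
      rw [h1, results_succ_of_probe g hp, ← add_assoc, hist_succ, hist_add]
      have h2 := iterate_next_of_buf g (talk plan (results plan g J)).length
        (h := hist plan g (segStart plan g J)) (pre := talk plan (results plan g J)) (rest := []) rfl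
        (by simpa using ih)
      exact (next_of_probe g h2.2 hp).2

/-- Inside the `J`-th segment of a probing brain the history is the segment start followed by a
prefix of the talk. [folklore] -/
theorem hist_segStart_add (g : List Bool → Bool) (J : ℕ) {i : ℕ}
    (hi : i ≤ (talk plan (results plan g J)).length) :
    hist plan g (segStart plan g J + i) = hist plan g (segStart plan g J) ++ (talk plan (results plan g J)).take i ∧
      state plan (hist plan g (segStart plan g J + i)) =
        ⟨results plan g J, (talk plan (results plan g J)).drop i⟩ := by
  rw [hist_add]
  have hs := state_hist_segStart (plan := plan) g J
  have h := iterate_next_of_buf g i (h := hist plan g (segStart plan g J))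
    (pre := (talk plan (results plan g J)).take i) (rest := (talk plan (results plan g J)).drop i)
    (List.length_take_of_le hi) (by rwa [List.take_append_drop])
  exact h

/-- After the talk of a probing segment comes the probe answer. [folklore] -/
theorem hist_segStart_succ_of_probe (g : List Bool → Bool) (J : ℕ) {z : List Bool}
    (hp : plan (results plan g J) = .probe z) :
    hist plan g (segStart plan g (J + 1)) =
      hist plan g (segStart plan g J) ++ talk plan (results plan g J) ++ [g z] := by
  have h1 : segStart plan g (J + 1) = segStart plan g J + (talk plan (results plan g J)).length + 1 := by
    simp [segStart, hp, add_assoc]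
  obtain ⟨h2, h3⟩ := hist_segStart_add (plan := plan) g J (i := (talk plan (results plan g J)).length) le_rfl
  rw [List.take_length] at h2
  rw [List.drop_length] at h3
  rw [h1, hist_succ, h2, (next_of_probe g (h2 ▸ h3) hp).1]

/-- **After the brain halts every further bit is the verdict**: if `plan (results J) = halt v`
then the history at any round `≥ segStart J` is the segment start followed by `v`s. [folklore] -/
theorem hist_of_halt (g : List Bool → Bool) {J : ℕ} {v : Bool} (hp : plan (results plan g J) = .halt v)
    (i : ℕ) : hist plan g (segStart plan g J + i) = hist plan g (segStart plan g J) ++ List.replicate i v := by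
  rw [hist_add]
  have hs := state_hist_segStart (plan := plan) g J
  have ht : talk plan (results plan g J) = List.replicate 2 v := by simp [talk, hp, List.replicate]
  rw [ht] at hs
  exact (iterate_next_of_halt g hp i hs).1

/-- **Bound on the halting round**: if the first `J` actions probe strings of length `≤ ℓ`, the
`J`-th segment starts by round `J (2ℓ + 5)`. [folklore] -/
theorem segStart_le (g : List Bool → Bool) {ℓ : ℕ}
    (hlen : ∀ J z, plan (results plan g J) = .probe z → z.length ≤ ℓ) :
    ∀ J : ℕ, segStart plan g J ≤ J * (2 * ℓ + 5)
  | 0 => by simp [segStart]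
  | J + 1 => by
    have ih := segStart_le g hlen J
    cases hp : plan (results plan g J) with
    | halt v =>
      have h1 : segStart plan g (J + 1) = segStart plan g J := by simp [segStart, hp]
      rw [h1]; nlinarith
    | probe z =>
      have h1 : segStart plan g (J + 1) = segStart plan g J + ((talk plan (results plan g J)).length + 1) := by
        simp [segStart, hp]
      have h2 : (talk plan (results plan g J)).length = 2 * z.length + 4 := by simp [talk, hp]
      have h3 := hlen J z hp
      rw [h1, h2]; nlinarith

/-! ### Every round lies in a segment -/

/-- Segment starts do not decrease. [folklore] -/
theorem segStart_le_succ (g : List Bool → Bool) (J : ℕ) : segStart plan g J ≤ segStart plan g (J + 1) := by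
  cases hp : plan (results plan g J) with
  | probe z => simp [segStart, hp]
  | halt v => simp [segStart, hp]

/-- Segment starts are monotone. [folklore] -/
theorem segStart_mono (g : List Bool → Bool) : ∀ {J J' : ℕ}, J ≤ J' → segStart plan g J ≤ segStart plan g J' := by
  intro J J' hJJ'
  induction hJJ' with
  | refl => exact le_rfl
  | @step J' _ ih => exact ih.trans (segStart_le_succ g J')

/-- **Round classification.** Every round `r` either lies in a probing segment `J` (at offset
`i ≤ |talk|` from its start, all earlier actions being probes), or comes after the start of a
halted segment. [folklore] -/
theorem round_cases (g : List Bool → Bool) (r : ℕ) :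
    (∃ J i z, plan (results plan g J) = .probe z ∧ i ≤ (talk plan (results plan g J)).length ∧
        r = segStart plan g J + i) ∨
      (∃ J i v, plan (results plan g J) = .halt v ∧ r = segStart plan g J + i) := by
  -- the largest `J ≤ r` whose segment starts at or before `r` (segment starts of probing runs
  -- increase by at least one per segment)
  have key : ∀ J : ℕ, (∀ J' < J, ∃ z, plan (results plan g J') = .probe z) → J ≤ segStart plan g J := by
    intro J
    induction J with
    | zero => intro; exact le_rfl
    | succ J ih =>
      intro hJ
      obtain ⟨z, hz⟩ := hJ J (Nat.lt_succ_self J)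
      have h1 : segStart plan g (J + 1) = segStart plan g J + ((talk plan (results plan g J)).length + 1) := by
        simp [segStart, hz]
      have := ih fun J' hJ' => hJ J' (Nat.lt_succ_of_lt hJ')
      omega
  by_cases hex : ∃ J ≤ r, ∃ v, plan (results plan g J) = .halt v ∧ segStart plan g J ≤ r
  · obtain ⟨J, -, v, hv, hle⟩ := hex
    exact Or.inr ⟨J, r - segStart plan g J, v, hv, by omega⟩
  · push Not at hex
    -- all segments `J ≤ r` starting by round `r` probe; take the last one starting by `r`
    left
    have hprobe : ∀ J ≤ r, segStart plan g J ≤ r → ∃ z, plan (results plan g J) = .probe z := by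
      intro J hJ hle
      cases hp : plan (results plan g J) with
      | probe z => exact ⟨z, rfl⟩
      | halt v => exact absurd hle (not_le.2 (hex J hJ v hp))
    -- the set of `J ≤ r` with `segStart J ≤ r` is nonempty (`J = 0`) and bounded; take its max
    classical
    let P : ℕ → Prop := fun J => J ≤ r ∧ segStart plan g J ≤ r
    have hP0 : P 0 := ⟨Nat.zero_le _, by simp [segStart]⟩
    let J := Nat.findGreatest P r
    have hPJ : P J := Nat.findGreatest_spec (P := P) (Nat.zero_le r) hP0
    obtain ⟨z, hz⟩ := hprobe J hPJ.1 hPJ.2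
    refine ⟨J, r - segStart plan g J, z, hz, ?_, by omega⟩
    -- if the offset exceeded the talk, segment `J + 1` would start by `r`
    by_contra hlt
    push Not at hlt
    have h1 : segStart plan g (J + 1) = segStart plan g J + ((talk plan (results plan g J)).length + 1) := by
      simp [segStart, hz]
    have hle' : segStart plan g (J + 1) ≤ r := by omega
    -- all `J' ≤ J` probe, hence `J + 1 ≤ segStart (J+1) ≤ r`
    have hall : ∀ J' < J + 1, ∃ z, plan (results plan g J') = .probe z := by
      intro J' hJ'
      have hJ'le : J' ≤ J := Nat.lt_succ_iff.1 hJ'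
      exact hprobe J' (hJ'le.trans hPJ.1) ((segStart_mono g hJ'le).trans hPJ.2)
    have hJ1 : J + 1 ≤ r := (key (J + 1) hall).trans hle'
    have hPJ1 : P (J + 1) := ⟨hJ1, hle'⟩
    have := Nat.le_findGreatest (P := P) hJ1 hPJ1
    omega

/-! ### The two transducers -/

/-- States of the pending-probe detector: at a token boundary, after the first bit `b` of a
token, or right after a completed `MARK` (a probe answer is awaited). [folklore] -/
inductive PS
  | t0
  | t1 (b : Bool)
  | pa
  deriving DecidableEq, Fintype

/-- Transition of the detector: `SEP = 00` and `DATA = 1b` return to the boundary, `MARK = 01`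
announces a probe, whose answer bit returns to the boundary. [folklore] -/
def pendStep : PS → Bool → PS
  | .t0, c => .t1 c
  | .t1 true, _ => .t0
  | .t1 false, true => .pa
  | .t1 false, false => .t0
  | .pa, _ => .t0

/-- **The pending-probe detector**: emits nothing and announces `[state = pa]`. [folklore] -/
def pendT : FST PS Bool Bool where
  init := .t0
  step s c := (pendStep s c, [])
  front s := [decide (s = .pa)]
  keep _ := false

/-- The transition of `pendT` (definitional). [folklore] -/
@[simp] theorem pendT_step (s : PS) (c : Bool) : pendT.step s c = (pendStep s c, []) := rfl

/-- The run of `pendT` emits nothing; its state is the fold of `pendStep`. [folklore] -/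
theorem pendT_run (s : PS) (w : List Bool) : pendT.run s w = (w.foldl pendStep s, []) := by
  induction w generalizing s with
  | nil => rfl
  | cons c w ih => rw [FST.run_cons, pendT_step, ih]; simp

/-- `pendT w = [decide (fold = pa)]`. [folklore] -/
theorem pendT_eval (w : List Bool) : pendT.eval w = [decide (w.foldl pendStep .t0 = .pa)] := by
  rw [FST.eval, show pendT.init = PS.t0 from rfl, pendT_run]; simp [pendT]

/-- `dataBits z` read forwards: the tokens `DATA b = 1b` for the bits of `z` in reverse order.
[folklore] -/
theorem dataBits_eq (z : List Bool) : dataBits z = z.reverse.flatMap fun b => [true, b] := by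
  rw [dataBits, List.reverse_flatMap]; rfl

/-- Reading data tokens from the boundary returns to the boundary. [folklore] -/
theorem foldl_pendStep_flatMap_data (l : List Bool) : (l.flatMap fun b => [true, b]).foldl pendStep .t0 = .t0 := by
  induction l with
  | nil => rfl
  | cons b l ih => simp [List.flatMap_cons, pendStep, ih]

/-- Reading `dataBits z` from the boundary returns to the boundary. [folklore] -/
theorem foldl_pendStep_dataBits (z : List Bool) : (dataBits z).foldl pendStep .t0 = .t0 := by
  rw [dataBits_eq]; exact foldl_pendStep_flatMap_data _

/-- **A full probe talk ends in the probe state.** [folklore] -/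
theorem foldl_pendStep_probeTalk (z : List Bool) : (probeTalk z).foldl pendStep .t0 = .pa := by
  simp [probeTalk, List.foldl_append, pendStep, foldl_pendStep_dataBits]

/-- Prefixes of a run of data tokens sit at the boundary or right after a `1`. [folklore] -/
theorem foldl_pendStep_take_flatMap_data (l : List Bool) : ∀ i : ℕ,
    (List.take i (l.flatMap fun b => [true, b])).foldl pendStep .t0 = .t0 ∨
      (List.take i (l.flatMap fun b => [true, b])).foldl pendStep .t0 = .t1 true := by
  induction l with
  | nil => intro i; simp
  | cons b l ih =>
    intro i
    match i with
    | 0 => simp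
    | 1 => simp [pendStep]
    | i + 2 =>
      simp only [List.flatMap_cons, List.cons_append, List.nil_append, List.take_succ_cons,
        List.foldl_cons, pendStep]
      exact ih i

/-- Proper prefixes of `dataBits z` sit at the boundary or right after a `1` (never in the probe
state). [folklore] -/
theorem foldl_pendStep_take_dataBits (z : List Bool) (i : ℕ) :
    (List.take i (dataBits z)).foldl pendStep .t0 = .t0 ∨ (List.take i (dataBits z)).foldl pendStep .t0 = .t1 true := by
  rw [dataBits_eq]; exact foldl_pendStep_take_flatMap_data _ i

/-- **Proper prefixes of a probe talk never reach the probe state.** [folklore] -/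
theorem foldl_pendStep_take_probeTalk (z : List Bool) {i : ℕ} (hi : i < (probeTalk z).length) :
    (List.take i (probeTalk z)).foldl pendStep .t0 ≠ .pa := by
  rw [probeTalk]
  match i with
  | 0 => simp
  | 1 => simp [pendStep]
  | i + 2 =>
    simp only [List.cons_append, List.nil_append, List.take_succ_cons, List.foldl_cons, pendStep,
      List.take_append]
    rw [List.foldl_append]
    rcases foldl_pendStep_take_dataBits z i with h | h
    · rw [h]
      -- the rest is a prefix of `MARK = 01` of length `< 2`
      have hlt : i - (dataBits z).length < 2 := by
        simp [probeTalk] at hi; omega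
      match hm : i - (dataBits z).length with
      | 0 => simp
      | 1 => simp [pendStep]
      | k + 2 => omega
    · rw [h]
      match hm : i - (dataBits z).length with
      | 0 => simp
      | 1 => simp [pendStep]
      | k + 2 =>
        have : i - (dataBits z).length < 2 := by simp [probeTalk] at hi; omega
        omega

/-- Idle bits never reach the probe state. [folklore] -/
theorem foldl_pendStep_replicate (v : Bool) (i : ℕ) :
    (List.replicate i v).foldl pendStep .t0 = .t0 ∨ (List.replicate i v).foldl pendStep .t0 = .t1 v := by
  induction i using Nat.twoStepInduction with
  | zero => simp
  | one => simp [pendStep]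
  | more i ih _ =>
    rw [show i + 2 = 2 + i from add_comm _ _, List.replicate_add]
    simp only [List.foldl_append]
    have h2 : (List.replicate 2 v).foldl pendStep .t0 = .t0 := by cases v <;> rfl
    rw [h2]; exact ih

/-- States of the extractor: expecting the reversed `MARK` (`1`, then `0`), reading data pairs
`b 1` (emit `b`), done. [folklore] -/
inductive ES
  | m0
  | m1
  | rd
  | rb (b : Bool)
  | done
  deriving DecidableEq, Fintype

/-- Transition of the extractor on the REVERSED history: `10` (reversed `MARK`), then pairs
`b1` (reversed `DATA b`, emit `b`) until a pair `_0` (reversed `SEP`). [folklore] -/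
def extStep : ES → Bool → ES × List Bool
  | .m0, true => (.m1, [])
  | .m0, false => (.done, [])
  | .m1, false => (.rd, [])
  | .m1, true => (.done, [])
  | .rd, c => (.rb c, [])
  | .rb b, true => (.rd, [b])
  | .rb _, false => (.done, [])
  | .done, _ => (.done, [])

/-- **The probe-string extractor** (run on the reversed history). [folklore] -/
def extT : FST ES Bool Bool where
  init := .m0
  step := extStep
  front _ := []
  keep _ := true

/-- The transition of `extT` (definitional). [folklore] -/
@[simp] theorem extT_step (s : ES) (c : Bool) : extT.step s c = extStep s c := rfl

/-- In state `done` the extractor emits nothing more. [folklore] -/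
theorem extT_run_done (w : List Bool) : (extT.run .done w).2 = [] := by
  induction w with
  | nil => rfl
  | cons c w ih => rw [FST.run_cons, extT_step]; simpa [extStep] using ih

/-- Reading the reversed data `z₀ 1 z₁ 1 ⋯` followed by a reversed `SEP` emits `z`. [folklore] -/
theorem extT_run_rd (z t : List Bool) :
    (extT.run .rd ((z.flatMap fun b => [b, true]) ++ false :: false :: t)).2 = z := by
  induction z with
  | nil =>
    rw [List.flatMap_nil, List.nil_append, FST.run_cons, extT_step]
    simp only [extStep, List.nil_append]
    rw [FST.run_cons, extT_step]
    simp only [extStep, List.nil_append]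
    exact extT_run_done t
  | cons b z ih =>
    simp only [List.flatMap_cons, List.cons_append, List.nil_append]
    rw [FST.run_cons, extT_step]
    simp only [extStep, List.nil_append]
    rw [FST.run_cons, extT_step]
    simp only [extStep, List.singleton_append]
    rw [ih]

/-- **The extractor recovers the probed string** from the reversed history `h₀ · probeTalk z`.
[folklore] -/
theorem extT_eval_reverse (h₀ z : List Bool) : extT.eval (h₀ ++ probeTalk z).reverse = z := by
  have hrev : (h₀ ++ probeTalk z).reverse =
      true :: false :: ((z.flatMap fun b => [b, true]) ++ false :: false :: h₀.reverse) := by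
    simp [probeTalk, dataBits, List.reverse_append]
  rw [FST.eval, hrev, show extT.init = ES.m0 from rfl, FST.run_cons, extT_step]
  simp only [extStep, List.nil_append]
  rw [FST.run_cons, extT_step]
  simp only [extStep, List.nil_append]
  rw [extT_run_rd z h₀.reverse]
  simp [extT]

/-- The last-bit announcer: state = last bit read (initially `0`). [folklore] -/
def lastT : FST Bool Bool Bool where
  init := false
  step _ c := (c, [])
  front s := [s]
  keep _ := false

/-- The transition of `lastT` (definitional). [folklore] -/
@[simp] theorem lastT_step (s c : Bool) : lastT.step s c = (c, []) := rfl

/-- The run of `lastT`. [folklore] -/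
theorem lastT_run (s : Bool) (w : List Bool) : lastT.run s w = ((s :: w).getLast (by simp), []) := by
  induction w generalizing s with
  | nil => rfl
  | cons c w ih => rw [FST.run_cons, lastT_step, ih]; simp

/-- `lastT (w ++ [b]) = [b]`. [folklore] -/
theorem lastT_eval_append_singleton (w : List Bool) (b : Bool) : lastT.eval (w ++ [b]) = [b] := by
  rw [FST.eval, show lastT.init = false from rfl, lastT_run]
  simp [lastT]

/-- `lastT` always announces one bit. [folklore] -/
theorem lastT_eval_eq_or (w : List Bool) : lastT.eval w = [true] ∨ lastT.eval w = [false] := by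
  rw [FST.eval, show lastT.init = false from rfl, lastT_run]
  simp only [lastT]
  cases (false :: w).getLast (by simp) <;> simp

/-! ### The machine: query map and verdict -/

/-- Histories ending with a completed `MARK`. [folklore] -/
def PendLang : Language Bool := {h | pendT.eval h = [true]}

/-- `PendLang ∈ P`. [folklore] -/
theorem PendLang_mem_P : PendLang ∈ Classes.P :=
  mem_P_of_mem_FP pendT.polyTimeComputable_eval _ fun w =>
    ⟨fun h => h, fun h => by
      have h' : pendT.eval w ≠ [true] := h
      rw [pendT_eval] at h' ⊢
      revert h'; cases decide (List.foldl pendStep PS.t0 w = PS.pa) <;> simp⟩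

/-- Histories whose last bit is `1`. [folklore] -/
def LastTrue : Language Bool := {h | lastT.eval h = [true]}

/-- `LastTrue ∈ P`. [folklore] -/
theorem LastTrue_mem_P : LastTrue ∈ Classes.P :=
  mem_P_of_mem_FP lastT.polyTimeComputable_eval _ fun w =>
    ⟨fun h => h, fun h => (lastT_eval_eq_or w).resolve_left h⟩

/-- Membership of `w ++ [b]` in `LastTrue`. [folklore] -/
@[simp] theorem append_singleton_mem_LastTrue (w : List Bool) (b : Bool) : w ++ [b] ∈ LastTrue ↔ b = true := by
  change lastT.eval (w ++ [b]) = [true] ↔ _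
  rw [lastT_eval_append_singleton]; simp

/-- The probe query `1 · extT (reverse h)` computed from `⟨x, h⟩`. [folklore] -/
noncomputable def probeFn : List Bool → List Bool := List.cons true ∘ extT.eval ∘ List.reverse ∘ sndP

/-- The brain question `0 · ⟨pay x, h⟩` computed from `⟨x, h⟩`. [folklore] -/
noncomputable def askFn (pay : List Bool → List Bool) : List Bool → List Bool :=
  List.cons false ∘ fanoutFn (pay ∘ fstP) sndP

/-- **The query map**: probe if a `MARK` was just completed, else ask the brain. [cite: FortnowRogers1999JCSS, proof of Thm. 4.2 (p. 7)] -/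
noncomputable def qryFn (pay : List Bool → List Bool) : List Bool → List Bool :=
  condFn (sndP ⁻¹' PendLang) probeFn (askFn pay)

/-- The verdict language: accept iff the last answer bit is `1`. [folklore] -/
def Verdict : Language Bool := sndP ⁻¹' LastTrue

/-- `probeFn ∈ FP`. [folklore] -/
theorem probeFn_mem_FP : probeFn ∈ FP :=
  comp_mem_FP (cons_mem_FP true) (comp_mem_FP extT.polyTimeComputable_eval (comp_mem_FP BinSearchPP.reverse_mem_FP sndP_mem_FP))

/-- `askFn pay ∈ FP` for `pay ∈ FP`. [folklore] -/
theorem askFn_mem_FP {pay : List Bool → List Bool} (hpay : pay ∈ FP) : askFn pay ∈ FP :=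
  comp_mem_FP (cons_mem_FP false) (fanoutFn_mem_FP (comp_mem_FP hpay fstP_mem_FP) sndP_mem_FP)

/-- **The query map is polynomial-time.** [cite: AroraBarakCC2009, §3.4] -/
theorem qryFn_mem_FP {pay : List Bool → List Bool} (hpay : pay ∈ FP) : qryFn pay ∈ FP :=
  condFn_mem_FP (preimage_mem_P PendLang_mem_P sndP_mem_FP) probeFn_mem_FP (askFn_mem_FP hpay)

/-- **The verdict language is in `P`.** [folklore] -/
theorem Verdict_mem_P : Verdict ∈ Classes.P := preimage_mem_P LastTrue_mem_P sndP_mem_FP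

/-- The query on a history ending with a completed `MARK` is the probe. [folklore] -/
theorem qryFn_of_pend (pay : List Bool → List Bool) {x h : List Bool} (hh : h ∈ PendLang) :
    qryFn pay (boolPair x h) = true :: extT.eval h.reverse := by
  have hm : boolPair x h ∈ sndP ⁻¹' PendLang := by
    change sndP (boolPair x h) ∈ PendLang
    rw [sndP_boolPair]; exact hh
  rw [qryFn, condFn_of_mem _ _ hm]
  simp [probeFn]

/-- Otherwise the query is the brain question. [folklore] -/
theorem qryFn_of_not_pend (pay : List Bool → List Bool) {x h : List Bool} (hh : h ∉ PendLang) :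
    qryFn pay (boolPair x h) = false :: boolPair (pay x) h := by
  have hm : boolPair x h ∉ sndP ⁻¹' PendLang := by
    change sndP (boolPair x h) ∉ PendLang
    rw [sndP_boolPair]; exact hh
  rw [qryFn, condFn_of_not_mem _ _ hm]
  simp [askFn]

/-- **The protocol language** with payload `pay`, round budget `q`, brain oracle `K` and probe
oracle `G`: the language of `adAlg (qryFn pay) q Verdict` relative to `K ⊕ G`. [cite: FortnowRogers1999JCSS, proof of Thm. 4.2 (p. 7)] -/
noncomputable def protoLang (pay : List Bool → List Bool) (q : Polynomial ℕ) (K G : Set (List Bool)) : Language Bool :=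
  AdQuery.adLang (qryFn pay) q Verdict (joinLang K G)

/-- **The protocol language is in `P^{K ⊕ G}`** (`adLang_mem_PRel`). [cite: LadnerLynchSelman1975, §2] [cite: AroraBarakCC2009, §3.4] -/
theorem protoLang_mem_PRel {pay : List Bool → List Bool} (hpay : pay ∈ FP) (q : Polynomial ℕ) (K G : Set (List Bool)) :
    protoLang pay q K G ∈ PRel (Oracle.ofLanguage (joinLang K G)) :=
  AdQuery.adLang_mem_PRel (qryFn_mem_FP hpay) Verdict_mem_P _

/-! ### The canonical run is the machine's run -/

/-- On the canonical history of round `r` the detector announces a probe iff a probe is pending,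
and then the extractor recovers the probed string. [folklore] -/
theorem pend_hist (g : List Bool → Bool) (r : ℕ) :
    (hist plan g r ∈ PendLang ↔ pending plan (hist plan g r) ≠ none) ∧
      ∀ z, pending plan (hist plan g r) = some z → extT.eval (hist plan g r).reverse = z := by
  -- segment starts sit at the detector's boundary state
  have hbd : ∀ J, (hist plan g (segStart plan g J)).foldl pendStep .t0 = .t0 := by
    intro J
    induction J with
    | zero => rfl
    | succ J ih =>
      cases hp : plan (results plan g J) with
      | halt v =>
        have h1 : segStart plan g (J + 1) = segStart plan g J := by simp [segStart, hp]
        rwa [h1]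
      | probe z =>
        rw [hist_segStart_succ_of_probe g J hp, List.foldl_append, List.foldl_append, ih]
        simp [talk, hp, foldl_pendStep_probeTalk, pendStep]
  have hmem : ∀ h : List Bool, h ∈ PendLang ↔ h.foldl pendStep .t0 = .pa := fun h => by
    change pendT.eval h = [true] ↔ _
    rw [pendT_eval]; simp
  rcases round_cases (plan := plan) g r with ⟨J, i, z, hp, hi, rfl⟩ | ⟨J, i, v, hp, rfl⟩
  · obtain ⟨hh, hs⟩ := hist_segStart_add (plan := plan) g J hi
    have ht : talk plan (results plan g J) = probeTalk z := by simp [talk, hp]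
    rcases hi.lt_or_eq with hlt | heq
    · -- inside the talk: not pending, detector not in `pa`
      rw [ht] at hlt hh hs
      have hpend : pending plan (hist plan g (segStart plan g J + i)) = none := by
        obtain ⟨b, rest, hbr⟩ : ∃ b rest, (probeTalk z).drop i = b :: rest := by
          cases hd : (probeTalk z).drop i with
          | nil => exact absurd (List.drop_eq_nil_iff.1 hd) (not_le.2 hlt)
          | cons b rest => exact ⟨b, rest, rfl⟩
        simp [pending, hs, hbr]
      refine ⟨⟨fun hP => ?_, fun hP => absurd hpend hP⟩, fun z' hz' => by rw [hpend] at hz'; cases hz'⟩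
      rw [hmem, hh, List.foldl_append, hbd] at hP
      exact absurd hP (foldl_pendStep_take_probeTalk z hlt)
    · -- the talk is complete: pending `z`, detector in `pa`, extractor finds `z`
      subst heq
      rw [List.take_length] at hh
      rw [List.drop_length] at hs
      have hpend : pending plan (hist plan g (segStart plan g J + (talk plan (results plan g J)).length)) = some z := by
        simp [pending, hs, hp]
      refine ⟨⟨fun _ => by simp [hpend], fun _ => ?_⟩, fun z' hz' => ?_⟩
      · rw [hmem, hh, List.foldl_append, hbd, ht, foldl_pendStep_probeTalk]
      · rw [hpend, Option.some.injEq] at hz'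
        subst hz'
        rw [hh, ht, extT_eval_reverse]
  · -- halted: idle bits, never pending
    have hh := hist_of_halt (plan := plan) g hp i
    obtain ⟨k, hs⟩ := (iterate_next_of_halt (plan := plan) g hp i
      (h := hist plan g (segStart plan g J)) (k := 2)
      (by simpa [talk, hp, List.replicate] using state_hist_segStart (plan := plan) g J)).2
    rw [← hist_add] at hs
    have hpend : pending plan (hist plan g (segStart plan g J + i)) = none := by
      cases k with
      | zero => simp [pending, hs, hp]
      | succ k => simp [pending, hs, List.replicate_succ]
    refine ⟨⟨fun hP => ?_, fun hP => absurd hpend hP⟩, fun z' hz' => by rw [hpend] at hz'; cases hz'⟩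
    rw [hmem, hh, List.foldl_append, hbd] at hP
    rcases foldl_pendStep_replicate v i with h | h <;> rw [h] at hP <;> cases hP

/-- **The machine's answer bits are the canonical history**, provided the brain oracle `K`
answers the question `⟨pay x, h⟩` with the brain's bit `kbit plan h` (for the brain `plan` of the
instance `x`), the probe answers being the true ones, `g = G.boolIndicator`. [cite: FortnowRogers1999JCSS, proof of Thm. 4.2 (p. 7)] -/
theorem adBits_eq_hist {pay : List Bool → List Bool} {K G : Set (List Bool)} {x : List Bool}
    (hK : ∀ h : List Bool, boolPair (pay x) h ∈ K ↔ kbit plan h = true) (r : ℕ) :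
    AdQuery.adBits (qryFn pay) (joinLang K G) x r = hist plan G.boolIndicator r := by
  induction r with
  | zero => rfl
  | succ r ih =>
    rw [AdQuery.adBits_succ, ih, hist_succ, next]
    congr 1
    rw [List.singleton_inj]
    obtain ⟨hpend, hext⟩ := pend_hist (plan := plan) G.boolIndicator r
    cases hq : pending plan (hist plan G.boolIndicator r) with
    | some z =>
      have hP : hist plan G.boolIndicator r ∈ PendLang := hpend.2 (by rw [hq]; simp)
      rw [qryFn_of_pend pay hP, hext z hq, nextBit_of_pending_some plan hq]
      -- the answer of `K ⊕ G` on `1z` is `G`'s answer on `z`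
      rcases Bool.eq_false_or_eq_true (G.boolIndicator z) with h | h
      · rw [h]; exact (Set.mem_iff_boolIndicator _ _).1 (by simpa using (Set.mem_iff_boolIndicator _ _).2 h)
      · rw [h]; exact (Set.notMem_iff_boolIndicator _ _).1 (by simpa using (Set.notMem_iff_boolIndicator _ _).2 h)
    | none =>
      have hP : hist plan G.boolIndicator r ∉ PendLang := fun hP => (hpend.1 hP) hq
      rw [qryFn_of_not_pend pay hP, nextBit_of_pending_none plan hq]
      rcases Bool.eq_false_or_eq_true (kbit plan (hist plan G.boolIndicator r)) with h | h
      · rw [h]; exact (Set.mem_iff_boolIndicator _ _).1 (by simpa using (hK _).2 h)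
      · rw [h]
        refine (Set.notMem_iff_boolIndicator _ _).1 ?_
        simp only [false_cons_mem_joinLang]
        exact fun hm => by simpa [h] using (hK _).1 hm

/-- **The protocol theorem.** If `K` answers the brain's questions for the instance `x` and the
brain halts after `J` probes with verdict `v` — `plan (results plan g J) = halt v`,
`g = G.boolIndicator` — then for every round budget beyond the start of the halted segment,
`x ∈ protoLang pay q K G ↔ v = true`. [cite: FortnowRogers1999JCSS, proof of Thm. 4.2 (p. 7)] -/
theorem mem_protoLang_iff {pay : List Bool → List Bool} {q : Polynomial ℕ} {K G : Set (List Bool)} {x : List Bool}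
    (hK : ∀ h : List Bool, boolPair (pay x) h ∈ K ↔ kbit plan h = true) {J : ℕ} {v : Bool}
    (hJ : plan (results plan G.boolIndicator J) = .halt v) (hq : segStart plan G.boolIndicator J < q.eval x.length) :
    x ∈ protoLang pay q K G ↔ v = true := by
  rw [protoLang, AdQuery.mem_adLang_iff, adBits_eq_hist hK]
  change sndP (boolPair x (hist plan G.boolIndicator (q.eval x.length))) ∈ LastTrue ↔ _
  rw [sndP_boolPair]
  obtain ⟨i, hi⟩ := Nat.exists_eq_add_of_lt hq
  rw [hi, show segStart plan G.boolIndicator J + i + 1 = segStart plan G.boolIndicator J + (i + 1) from rfl,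
    hist_of_halt G.boolIndicator hJ (i + 1), List.replicate_succ', ← List.append_assoc,
    append_singleton_mem_LastTrue]

/-- The same with an explicit polynomial bound: if all probed strings have length `≤ ℓ` and the
brain halts after `J` probes, any budget `q(|x|) > J (2ℓ + 5)` will do. [cite: FortnowRogers1999JCSS, proof of Thm. 4.2 (p. 7)] -/
theorem mem_protoLang_iff_of_le {pay : List Bool → List Bool} {q : Polynomial ℕ} {K G : Set (List Bool)} {x : List Bool}
    (hK : ∀ h : List Bool, boolPair (pay x) h ∈ K ↔ kbit plan h = true) {J ℓ : ℕ} {v : Bool}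
    (hJ : plan (results plan G.boolIndicator J) = .halt v)
    (hlen : ∀ J' z, plan (results plan G.boolIndicator J') = .probe z → z.length ≤ ℓ)
    (hq : J * (2 * ℓ + 5) < q.eval x.length) :
    x ∈ protoLang pay q K G ↔ v = true :=
  mem_protoLang_iff hK hJ ((segStart_le G.boolIndicator hlen J).trans_lt hq)

end BrainProtocol

end Literature.Computability.Complexity
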